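import Literature.NumberTheory.NumberFields.KurodaRelationOddPart
import HarnessLib

/-!
# The `S₃` (dihedral of order `6`) class number relation on the torsion prime to `3` —
# `#Cl(L)[q] · #Cl(L)[q]^{⟨σ,τ⟩ 2} = #Cl(L^{⟨σ⟩})[q] · #Cl(L)[q]^{⟨τ⟩ 2}`, in particular on `2`-parts

Topic `NumberTheory/NumberFields`.  THEOREM-ONLY file (no definition, no named fact, no `sorry`), written by the
prover seat `bsd-line-att-p3` g33 (cell `bsd-f1-sign2`, route `AlignedTransportAtTwo`, `--supports`
stmt-BirchSwinnertonDyer-22298; closes nothing; BSD is proved for no curve here).  Companion of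
`KurodaRelationOddPart.lean` (Klein four-group, ODD parts): here the group is `S₃ = ⟨σ, τ | σ³ = τ² = 1, τσ = σ²τ⟩`
and the torsion exponent `q` is only required to be PRIME TO `3` — so `q = 2^m` is allowed although `2 ∣ #S₃`.

## Statement

Let `L/F` be a finite Galois extension of number fields and `σ, τ ∈ Gal(L/F)` with `σ³ = 1`, `τ² = 1`,
`τσ = σ²τ`.  For `q` prime to `3` write `Cl(L)[q] = {c : c^q = 1}`.  Then
(`card_torsion_classGroup_symmetricThree`)

  `#Cl(L)[q] · #{c ∈ Cl(L)[q] : σc = c, τc = c}² = #Cl(L^{⟨σ⟩})[q] · #{c ∈ Cl(L)[q] : τc = c}²`,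

so `#Cl(L)[q] = #Cl(L^{⟨σ⟩})[q] · t²` with `t` the index of the `⟨σ,τ⟩`-fixed in the `τ`-fixed `q`-torsion classes
(`card_torsion_classGroup_eq_card_torsion_fixedField_mul_sq`): the `q`-torsion of the class group of an
`S₃`-extension is that of its quadratic resolvent `L^{⟨σ⟩}` times a PERFECT SQUARE, the square of an index of
AMBIGUOUS classes of the quadratic extension `L/L^{⟨τ⟩}` of the cubic subfield.  For `q` odd (and prime to `3`) this
is the classical Brauer–Kuroda relation `h_q(L) h_q(F)² = h_q(L^{⟨σ⟩}) h_q(L^{⟨τ⟩})²` in torsion-counting form; for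
`q = 2^m` the `τ`-fixed count is NOT `#Cl(L^{⟨τ⟩})[q]` (capitulation and genus in the quadratic step) — the exact
`2`-part relation `h₂(L) h₂(F)² = h₂(L^{⟨σ⟩}) h₂(L^{⟨τ⟩})²` holds in print by the analytic class number formula
([Bartel2012] Thm. 1.2: cyclic quotient `S₃/C₃`, `2 ∤ #C₃`), which the tree does not have; the present ALGEBRAIC form
with the ambiguous-class index is what the finite-group argument gives, and it suffices for `λ`-invariants
(`IwasawaTheory/SymmetricThreeTowerLambda.lean`).

## Proof (elementary; no character theory, no zeta functions)

§1 For an additive commutative group `A` with endomorphisms `σ, τ` satisfying the `S₃` relations and `q` prime to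
`3` (Bezout `3a + qb = 1`): on `A[q]` the `C₃`-norm `ν = 1 + σ + σ²` splits `A[q] = A[q]^σ ⊕ ker ν` (`x ↦ (a·ν x, x − a·ν x)`,
inverse `(y, z) ↦ y + z`, using `ν y = 3y` on `σ`-fixed `y` and `3a ≡ 1 (mod q)`), compatibly with `τ`; and on
`Z = ker ν ∩ A[q]` the map `Z^τ × Z^τ → Z`, `(x, y) ↦ x + σ y` is a bijection (inverse through `u = σ − σ²`, which
satisfies `u ∘ u = −3` on `ker ν` and `τ u = −u τ` up to the twist): an étale `C₂`-descent for the twisted `C₃`-action.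
Hence `#A[q] · (#A[q]^{σ,τ})² = #A[q]^σ · (#A[q]^τ)²` (`card_torsion_mul_card_fixed_sq_symmetricThree`).  §2 Apply §1 to
`Cl(L)` with the Galois action and identify `#Cl(L)[q]^{⟨σ⟩} = #Cl(L^{⟨σ⟩})[q]` by the tree's coprime descent
`KurodaOddPart.card_torsion_fixed_eq_card_torsion_fixedField` (`[L : L^{⟨σ⟩}] ∣ 3` is prime to `q`).

References: [Lemmermeyer1994] §1 (Kuroda's formula); [Bartel2012] A. Bartel, *On Brauer–Kuroda type relations of
S-class numbers in dihedral extensions*, J. reine angew. Math. 668 (2012), Thm. 1.1–1.2 (arXiv:0904.2416 pp. 3–4;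
Halter-Koch 1977 §4 and Lemmermeyer 2005 Thm. 2.2 for `D_{2p}` over special bases); [NeukirchANT1999] Ch. III §1
Prop. (1.6); [Washington1997] §10.1.
-/

noncomputable section

open scoped Classical NumberField nonZeroDivisors

namespace Literature.NumberTheory.NumberFields.KurodaSymmetricThree

open IsDedekindDomain Literature.NumberTheory.NumberFields

/-! ### §1 Commutative groups with an `S₃`-action: the torsion prime to `3` -/

section AddGroup

variable {A : Type*} [AddCommGroup A] (σ τ : A →+ A)

/-- Bezout for `gcd(3, q) = 1`: an integer `a` with `(3a) • x = x` whenever `q • x = 0`. [folklore] -/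
private theorem exists_three_mul_zsmul_eq {q : ℕ} (hq : Nat.Coprime 3 q) :
    ∃ a : ℤ, ∀ x : A, q • x = 0 → (3 * a) • x = x := by
  refine ⟨Nat.gcdA 3 q, fun x hx => ?_⟩
  have hbez : ((Nat.gcd 3 q : ℕ) : ℤ) = (3 : ℤ) * Nat.gcdA 3 q + (q : ℤ) * Nat.gcdB 3 q := by
    exact_mod_cast Nat.gcd_eq_gcd_ab 3 q
  rw [Nat.Coprime.gcd_eq_one hq] at hbez
  have hqx : ((q : ℤ) * Nat.gcdB 3 q) • x = 0 := by
    rw [mul_comm, mul_zsmul, natCast_zsmul, hx, zsmul_zero]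
  calc (3 * Nat.gcdA 3 q) • x = (3 * Nat.gcdA 3 q) • x + ((q : ℤ) * Nat.gcdB 3 q) • x := by rw [hqx, add_zero]
    _ = ((1 : ℕ) : ℤ) • x := by rw [← add_zsmul, ← hbez]
    _ = x := by simp

/-- **`C₃`-splitting of the `q`-torsion, `3 ∤ q`.**  With `ν x = x + σ x + σ² x`:
`#A[q] = #A[q]^{σ} · #(A[q] ∩ ker ν)`, and the same with the condition `τ x = x` added throughout, for an endomorphism `τ`
with `τσ = σ²τ` (`σ³ = 1`). The splitting is `x ↦ (a ν x, x − a ν x)`, `3a ≡ 1 (mod q)`. [folklore] -/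
private theorem card_torsion_eq_card_fixed_mul_card_normZero (hσ : ∀ x, σ (σ (σ x)) = x)
    (hτσ : ∀ x, τ (σ x) = σ (σ (τ x))) {q : ℕ} (hq : Nat.Coprime 3 q) (P : A → Prop)
    (hP : P = (fun _ => True) ∨ P = fun x => τ x = x) :
    Nat.card {x : A // q • x = 0 ∧ P x} =
      Nat.card {x : A // (q • x = 0 ∧ σ x = x) ∧ P x} *
        Nat.card {x : A // (q • x = 0 ∧ x + σ x + σ (σ x) = 0) ∧ P x} := by
  obtain ⟨a, ha⟩ := exists_three_mul_zsmul_eq (A := A) hq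
  -- the `C₃`-norm
  let nm : A →+ A := AddMonoidHom.id A + σ + σ.comp σ
  have nm_apply : ∀ x, nm x = x + σ x + σ (σ x) := fun x => rfl
  have σ_nm : ∀ x, σ (nm x) = nm x := fun x => by rw [nm_apply, map_add, map_add, hσ]; abel
  have nm_fixed : ∀ y, σ y = y → nm y = (3 : ℤ) • y := fun y hy => by
    rw [nm_apply, hy, hy]; abel
  have τσσ : ∀ x, τ (σ (σ x)) = σ (τ x) := fun x => by rw [hτσ, hτσ, hσ]
  have τ_nm : ∀ x, τ (nm x) = nm (τ x) := fun x => by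
    rw [nm_apply, nm_apply, map_add, map_add, τσσ, hτσ]; abel
  have nm_tors : ∀ x, q • x = 0 → q • nm x = 0 := fun x hx => by rw [← map_nsmul, hx, map_zero]
  -- `P` is compatible with everything
  have hP0 : ∀ x, P x → P (a • nm x) := by
    rcases hP with rfl | rfl
    · intro _ _; trivial
    · intro x (hx : τ x = x); show τ (a • nm x) = a • nm x; rw [map_zsmul, τ_nm, hx]
  have hP1 : ∀ x y, P x → P y → P (x - y) := by
    rcases hP with rfl | rfl
    · intro _ _ _ _; trivial
    · intro x y (hx : τ x = x) (hy : τ y = y); show τ (x - y) = x - y; rw [map_sub, hx, hy]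
  have hP2 : ∀ x y, P x → P y → P (x + y) := by
    rcases hP with rfl | rfl
    · intro _ _ _ _; trivial
    · intro x y (hx : τ x = x) (hy : τ y = y); show τ (x + y) = x + y; rw [map_add, hx, hy]
  -- the components of the splitting
  have compY : ∀ x, q • x = 0 → q • (a • nm x) = 0 ∧ σ (a • nm x) = a • nm x := fun x hx =>
    ⟨by rw [smul_comm, nm_tors x hx, smul_zero], by rw [map_zsmul, σ_nm]⟩
  have compZ : ∀ x, q • x = 0 →
      q • (x - a • nm x) = 0 ∧ (x - a • nm x) + σ (x - a • nm x) + σ (σ (x - a • nm x)) = 0 := by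
    intro x hx
    refine ⟨by rw [smul_sub, smul_comm, nm_tors x hx, smul_zero, hx, sub_zero], ?_⟩
    have h1 : (x - a • nm x) + σ (x - a • nm x) + σ (σ (x - a • nm x)) = nm (x - a • nm x) := (nm_apply _).symm
    rw [h1, map_sub, map_zsmul, nm_fixed (nm x) (σ_nm x), smul_smul, mul_comm, ha (nm x) (nm_tors x hx), sub_self]
  have sumYZ : ∀ y z : A, q • y = 0 → q • z = 0 → q • (y + z) = 0 := fun y z hy hz => by
    rw [smul_add, hy, hz, add_zero]
  have left : ∀ x : A, a • nm x + (x - a • nm x) = x := fun x => by abel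
  have right1 : ∀ y z, q • y = 0 → σ y = y → z + σ z + σ (σ z) = 0 → a • nm (y + z) = y := by
    intro y z hyq hyσ hz
    rw [map_add, nm_fixed y hyσ, (nm_apply z).trans hz, add_zero, smul_smul, mul_comm, ha y hyq]
  have right2 : ∀ y z, q • y = 0 → σ y = y → z + σ z + σ (σ z) = 0 → (y + z) - a • nm (y + z) = z := by
    intro y z hyq hyσ hz
    rw [right1 y z hyq hyσ hz, add_sub_cancel_left]
  refine (Nat.card_congr
    { toFun := fun x => (⟨⟨a • nm x.1, compY x.1 x.2.1, hP0 x.1 x.2.2⟩,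
        ⟨x.1 - a • nm x.1, compZ x.1 x.2.1, hP1 _ _ x.2.2 (hP0 x.1 x.2.2)⟩⟩ :
          {x : A // (q • x = 0 ∧ σ x = x) ∧ P x} × {x : A // (q • x = 0 ∧ x + σ x + σ (σ x) = 0) ∧ P x})
      invFun := fun yz => ⟨yz.1.1 + yz.2.1, sumYZ _ _ yz.1.2.1.1 yz.2.2.1.1, hP2 _ _ yz.1.2.2 yz.2.2.2⟩
      left_inv := fun x => Subtype.ext (left x.1)
      right_inv := fun yz => Prod.ext (Subtype.ext (right1 yz.1.1 yz.2.1 yz.1.2.1.1 yz.1.2.1.2 yz.2.2.1.2))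
        (Subtype.ext (right2 yz.1.1 yz.2.1 yz.1.2.1.1 yz.1.2.1.2 yz.2.2.1.2)) }).trans (Nat.card_prod _ _)

/-- **The étale `C₂`-descent that DOUBLES the non-`C₃` part.**  On `Z = A[q] ∩ ker(1 + σ + σ²)` (`3 ∤ q`) the map
`Z^τ × Z^τ → Z`, `(x, y) ↦ x + σ y` is a bijection, so `#Z = (#Z^τ)²`: its inverse sends `m` to `(m − σ y, y)` with
`y = u(−a·(m − τ m))`, `u = σ − σ²` (`u ∘ u = −3` on `ker(1 + σ + σ²)`). [folklore] -/
private theorem card_normZero_torsion_eq_sq (hσ : ∀ x, σ (σ (σ x)) = x) (hτ : ∀ x, τ (τ x) = x)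
    (hτσ : ∀ x, τ (σ x) = σ (σ (τ x))) {q : ℕ} (hq : Nat.Coprime 3 q) :
    Nat.card {x : A // (q • x = 0 ∧ x + σ x + σ (σ x) = 0) ∧ True} =
      Nat.card {x : A // (q • x = 0 ∧ x + σ x + σ (σ x) = 0) ∧ τ x = x} ^ 2 := by
  obtain ⟨a, ha⟩ := exists_three_mul_zsmul_eq (A := A) hq
  have τσσ : ∀ x, τ (σ (σ x)) = σ (τ x) := fun x => by rw [hτσ, hτσ, hσ]
  -- `u = σ − σ²`
  let u : A →+ A := σ - σ.comp σ
  have u_apply : ∀ x, u x = σ x - σ (σ x) := fun x => rfl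
  -- on `ker (1 + σ + σ²)`: `u (u w) = -3 w`
  have uu : ∀ w, w + σ w + σ (σ w) = 0 → u (u w) = (-3 : ℤ) • w := by
    intro w hw
    have h2 : σ (σ w) = -(w + σ w) := by
      rw [eq_neg_iff_add_eq_zero, add_comm]; exact hw
    simp only [u_apply, map_sub, hσ]
    rw [h2]; abel
  have nm_u : ∀ w, u w + σ (u w) + σ (σ (u w)) = 0 := fun w => by
    simp only [u_apply, map_sub, hσ]; abel
  have τ_u : ∀ w, τ (u w) = - u (τ w) := fun w => by
    rw [u_apply, u_apply, map_sub, τσσ, hτσ]; abel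
  have u_tors : ∀ w, q • w = 0 → q • u w = 0 := fun w hw => by rw [← map_nsmul, hw, map_zero]
  have nm_σ : ∀ y, y + σ y + σ (σ y) = 0 → σ y + σ (σ y) + σ (σ (σ y)) = 0 := fun y hy => by
    rw [hσ]; rw [← hy]; abel
  -- the second component of the inverse map
  let Y : A → A := fun m => u ((-a) • (m - τ m))
  have Y_def : ∀ m, Y m = u ((-a) • (m - τ m)) := fun m => rfl
  have Y_tors : ∀ m, q • m = 0 → q • Y m = 0 := fun m hm => by
    rw [Y_def]
    exact u_tors _ (by rw [smul_comm, smul_sub, hm, ← map_nsmul, hm, map_zero, sub_zero, smul_zero])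
  have Y_nm : ∀ m, Y m + σ (Y m) + σ (σ (Y m)) = 0 := fun m => nm_u _
  have Y_τ : ∀ m, τ (Y m) = Y m := fun m => by
    rw [Y_def, τ_u, map_zsmul, map_sub, hτ, ← map_neg, ← smul_neg, neg_sub]
  have Y_u : ∀ m, q • m = 0 → m + σ m + σ (σ m) = 0 → u (Y m) = m - τ m := by
    intro m hm hnm
    have h1 : τ m + σ (τ m) + σ (σ (τ m)) = 0 := by
      have h0 := congrArg τ hnm
      rw [map_add, map_add, map_zero, τσσ, hτσ] at h0
      calc τ m + σ (τ m) + σ (σ (τ m)) = τ m + σ (σ (τ m)) + σ (τ m) := by abel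
        _ = 0 := h0
    have hz : (m - τ m) + σ (m - τ m) + σ (σ (m - τ m)) = 0 := by
      rw [map_sub, map_sub]
      calc m - τ m + (σ m - σ (τ m)) + (σ (σ m) - σ (σ (τ m)))
          = (m + σ m + σ (σ m)) - (τ m + σ (τ m) + σ (σ (τ m))) := by abel
        _ = 0 := by rw [hnm, h1, sub_zero]
    have hzq : q • (m - τ m) = 0 := by rw [smul_sub, hm, ← map_nsmul, hm, map_zero, sub_zero]
    rw [Y_def, map_zsmul, map_zsmul, uu _ hz, smul_smul]
    have : (-a * -3 : ℤ) = 3 * a := by ring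
    rw [this, ha _ hzq]
  -- the first component `m - σ (Y m)`
  have X_tors : ∀ m, q • m = 0 → q • (m - σ (Y m)) = 0 := fun m hm => by
    rw [smul_sub, hm, ← map_nsmul, Y_tors m hm, map_zero, sub_zero]
  have X_nm : ∀ m, m + σ m + σ (σ m) = 0 →
      (m - σ (Y m)) + σ (m - σ (Y m)) + σ (σ (m - σ (Y m))) = 0 := by
    intro m hnm
    rw [map_sub, map_sub]
    calc m - σ (Y m) + (σ m - σ (σ (Y m))) + (σ (σ m) - σ (σ (σ (Y m))))
        = (m + σ m + σ (σ m)) - (σ (Y m) + σ (σ (Y m)) + σ (σ (σ (Y m)))) := by abel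
      _ = 0 := by rw [hnm, nm_σ _ (Y_nm m), sub_zero]
  have X_τ : ∀ m, q • m = 0 → m + σ m + σ (σ m) = 0 → τ (m - σ (Y m)) = m - σ (Y m) := by
    intro m hm hnm
    have hu := Y_u m hm hnm
    rw [u_apply] at hu
    rw [map_sub, hτσ, Y_τ]
    calc τ m - σ (σ (Y m)) = m - (m - τ m) - σ (σ (Y m)) := by abel
      _ = m - σ (Y m) := by rw [← hu]; abel
  -- the forward map `(x, y) ↦ x + σ y`
  have S_tors : ∀ x y, q • x = 0 → q • y = 0 → q • (x + σ y) = 0 := fun x y hx hy => by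
    rw [smul_add, hx, ← map_nsmul, hy, map_zero, add_zero]
  have S_nm : ∀ x y, x + σ x + σ (σ x) = 0 → y + σ y + σ (σ y) = 0 →
      (x + σ y) + σ (x + σ y) + σ (σ (x + σ y)) = 0 := by
    intro x y hx hy
    rw [map_add, map_add]
    calc x + σ y + (σ x + σ (σ y)) + (σ (σ x) + σ (σ (σ y)))
        = (x + σ x + σ (σ x)) + (σ y + σ (σ y) + σ (σ (σ y))) := by abel
      _ = 0 := by rw [hx, nm_σ _ hy, add_zero]
  have left : ∀ m, (m - σ (Y m)) + σ (Y m) = m := fun m => sub_add_cancel _ _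
  have rightY : ∀ x y, q • y = 0 → τ x = x → y + σ y + σ (σ y) = 0 → τ y = y → Y (x + σ y) = y := by
    intro x y hyq hxτ hyn hyτ
    have hz : (x + σ y) - τ (x + σ y) = u y := by
      rw [map_add, hxτ, hτσ, hyτ, u_apply]; abel
    rw [Y_def, hz, ← map_zsmul, uu _ (by rw [map_zsmul, map_zsmul, ← smul_add, ← smul_add, hyn, smul_zero]),
      smul_smul]
    have : (-3 * -a : ℤ) = 3 * a := by ring
    rw [this, ha y hyq]
  have rightX : ∀ x y, q • y = 0 → τ x = x → y + σ y + σ (σ y) = 0 → τ y = y →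
      (x + σ y) - σ (Y (x + σ y)) = x := by
    intro x y hyq hxτ hyn hyτ
    rw [rightY x y hyq hxτ hyn hyτ, add_sub_cancel_right]
  refine (Nat.card_congr
    { toFun := fun m => (⟨⟨m.1 - σ (Y m.1), ⟨X_tors m.1 m.2.1.1, X_nm m.1 m.2.1.2⟩, X_τ m.1 m.2.1.1 m.2.1.2⟩,
          ⟨Y m.1, ⟨Y_tors m.1 m.2.1.1, Y_nm m.1⟩, Y_τ m.1⟩⟩ :
          {x : A // (q • x = 0 ∧ x + σ x + σ (σ x) = 0) ∧ τ x = x} ×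
            {x : A // (q • x = 0 ∧ x + σ x + σ (σ x) = 0) ∧ τ x = x})
      invFun := fun xy => ⟨xy.1.1 + σ xy.2.1,
          ⟨S_tors _ _ xy.1.2.1.1 xy.2.2.1.1, S_nm _ _ xy.1.2.1.2 xy.2.2.1.2⟩, trivial⟩
      left_inv := fun m => Subtype.ext (left m.1)
      right_inv := fun xy =>
        Prod.ext (Subtype.ext (rightX xy.1.1 xy.2.1 xy.2.2.1.1 xy.1.2.2 xy.2.2.1.2 xy.2.2.2))
          (Subtype.ext (rightY xy.1.1 xy.2.1 xy.2.2.1.1 xy.1.2.2 xy.2.2.1.2 xy.2.2.2)) }).trans ?_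
  rw [Nat.card_prod, pow_two]

/-- **The `S₃` relation on `q`-torsion, `3 ∤ q` (additive form).**  `A` a commutative group, `σ, τ` endomorphisms with
`σ³ = 1`, `τ² = 1`, `τσ = σ²τ`: `#A[q] · (#A[q]^{σ,τ})² = #A[q]^{σ} · (#A[q]^{τ})²` — the finite-module shadow of
the Brauer relation `1 + 2·S₃ ∼ 2·C₂ + C₃` behind the dihedral class number relations.
[cite: Bartel2012, Thm. 1.2 (G = D_6 = S₃, N = C₃, p = 2 ∤ #N) and §1 (Brauer relations)] [cite: Lemmermeyer1994, §1] -/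
theorem card_torsion_mul_card_fixed_sq_symmetricThree_add (hσ : ∀ x, σ (σ (σ x)) = x) (hτ : ∀ x, τ (τ x) = x)
    (hτσ : ∀ x, τ (σ x) = σ (σ (τ x))) {q : ℕ} (hq : Nat.Coprime 3 q) :
    Nat.card {x : A // q • x = 0} * Nat.card {x : A // q • x = 0 ∧ σ x = x ∧ τ x = x} ^ 2 =
      Nat.card {x : A // q • x = 0 ∧ σ x = x} * Nat.card {x : A // q • x = 0 ∧ τ x = x} ^ 2 := by
  have e0 : Nat.card {x : A // q • x = 0} = Nat.card {x : A // q • x = 0 ∧ True} :=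
    Nat.card_congr (Equiv.subtypeEquivRight fun _ => ⟨fun h => ⟨h, trivial⟩, fun h => h.1⟩)
  have e1 : Nat.card {x : A // q • x = 0 ∧ σ x = x} = Nat.card {x : A // (q • x = 0 ∧ σ x = x) ∧ True} :=
    Nat.card_congr (Equiv.subtypeEquivRight fun _ => ⟨fun h => ⟨h, trivial⟩, fun h => h.1⟩)
  have e2 : Nat.card {x : A // q • x = 0 ∧ σ x = x ∧ τ x = x} =
      Nat.card {x : A // (q • x = 0 ∧ σ x = x) ∧ τ x = x} :=
    Nat.card_congr (Equiv.subtypeEquivRight fun _ => and_assoc.symm)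
  have h1 : Nat.card {x : A // q • x = 0 ∧ True} =
      Nat.card {x : A // (q • x = 0 ∧ σ x = x) ∧ True} *
        Nat.card {x : A // (q • x = 0 ∧ x + σ x + σ (σ x) = 0) ∧ True} :=
    card_torsion_eq_card_fixed_mul_card_normZero σ τ hσ hτσ hq (fun _ => True) (Or.inl rfl)
  have h2 : Nat.card {x : A // q • x = 0 ∧ τ x = x} =
      Nat.card {x : A // (q • x = 0 ∧ σ x = x) ∧ τ x = x} *
        Nat.card {x : A // (q • x = 0 ∧ x + σ x + σ (σ x) = 0) ∧ τ x = x} :=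
    card_torsion_eq_card_fixed_mul_card_normZero σ τ hσ hτσ hq (fun x => τ x = x) (Or.inr rfl)
  have h3 := card_normZero_torsion_eq_sq σ τ hσ hτ hτσ hq
  rw [e0, e1, e2, h1, h2, h3]
  ring

end AddGroup

section Group

variable {M : Type*} [CommGroup M] (σ τ : M →* M)

/-- **The `S₃` relation on `q`-torsion, `3 ∤ q` (multiplicative form).**  `M` a commutative group, `σ, τ`
endomorphisms with `σ³ = 1`, `τ² = 1`, `τσ = σ²τ`: `#M[q] · (#M[q]^{σ,τ})² = #M[q]^{σ} · (#M[q]^{τ})²`,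
`M[q] = {m : m^q = 1}` (finite-module shadow of the Brauer relation `1 + 2·S₃ ∼ 2·C₂ + C₃`).
[cite: Bartel2012, Thm. 1.2 (G = D_6 = S₃, N = C₃, p = 2 ∤ #N) and §1 (Brauer relations)] [cite: Lemmermeyer1994, §1] -/
theorem card_torsion_mul_card_fixed_sq_symmetricThree (hσ : ∀ m, σ (σ (σ m)) = m) (hτ : ∀ m, τ (τ m) = m)
    (hτσ : ∀ m, τ (σ m) = σ (σ (τ m))) {q : ℕ} (hq : Nat.Coprime 3 q) :
    Nat.card {m : M // m ^ q = 1} * Nat.card {m : M // m ^ q = 1 ∧ σ m = m ∧ τ m = m} ^ 2 =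
      Nat.card {m : M // m ^ q = 1 ∧ σ m = m} * Nat.card {m : M // m ^ q = 1 ∧ τ m = m} ^ 2 := by
  have hσ' : ∀ x : Additive M, MonoidHom.toAdditive σ (MonoidHom.toAdditive σ (MonoidHom.toAdditive σ x)) = x :=
    fun x => hσ x
  have hτ' : ∀ x : Additive M, MonoidHom.toAdditive τ (MonoidHom.toAdditive τ x) = x := fun x => hτ x
  have hτσ' : ∀ x : Additive M, MonoidHom.toAdditive τ (MonoidHom.toAdditive σ x) =
      MonoidHom.toAdditive σ (MonoidHom.toAdditive σ (MonoidHom.toAdditive τ x)) := fun x => hτσ x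
  have h := card_torsion_mul_card_fixed_sq_symmetricThree_add (A := Additive M) (MonoidHom.toAdditive σ)
    (MonoidHom.toAdditive τ) hσ' hτ' hτσ' hq
  have c0 : Nat.card {x : Additive M // q • x = 0} = Nat.card {m : M // m ^ q = 1} :=
    Nat.card_congr (Equiv.subtypeEquiv Additive.toMul fun _ => Iff.rfl)
  have c1 : Nat.card {x : Additive M // q • x = 0 ∧ MonoidHom.toAdditive σ x = x ∧ MonoidHom.toAdditive τ x = x} =
      Nat.card {m : M // m ^ q = 1 ∧ σ m = m ∧ τ m = m} :=
    Nat.card_congr (Equiv.subtypeEquiv Additive.toMul fun _ => Iff.rfl)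
  have c2 : Nat.card {x : Additive M // q • x = 0 ∧ MonoidHom.toAdditive σ x = x} =
      Nat.card {m : M // m ^ q = 1 ∧ σ m = m} :=
    Nat.card_congr (Equiv.subtypeEquiv Additive.toMul fun _ => Iff.rfl)
  have c3 : Nat.card {x : Additive M // q • x = 0 ∧ MonoidHom.toAdditive τ x = x} =
      Nat.card {m : M // m ^ q = 1 ∧ τ m = m} :=
    Nat.card_congr (Equiv.subtypeEquiv Additive.toMul fun _ => Iff.rfl)
  rw [c0, c1, c2, c3] at h
  exact h

end Group

/-! ### §2 The `S₃` class number relation, `q`-torsion form, `3 ∤ q` -/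

section Field

open NumberField

variable (F L : Type) [Field F] [Field L] [NumberField L] [Algebra F L]

/-- A class fixed by every generator in a set `S` is fixed by the subgroup `S` generates (ambiguous classes of
`⟨S⟩`). [cite: Lang1990, Ch. 13 §4 (ambiguous classes)] -/
theorem forall_mem_closure_smul_eq_of_forall {S : Set (L ≃ₐ[F] L)} {c : ClassGroup (𝓞 L)}
    (h : ∀ g ∈ S, ClassGroup.mulEquiv (AmbiguousClass.intAut g) c = c) :
    ∀ g ∈ Subgroup.closure S, ClassGroup.mulEquiv (AmbiguousClass.intAut g) c = c := by
  intro g hg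
  induction hg using Subgroup.closure_induction with
  | mem y hy => exact h y hy
  | one => rw [AmbiguousClass.mulEquiv_intAut_one, MulEquiv.refl_apply]
  | mul x y _ _ ihx ihy => rw [AmbiguousClass.mulEquiv_intAut_mul, MulEquiv.trans_apply, ihy, ihx]
  | inv x _ ih =>
    have h2 := congrArg (ClassGroup.mulEquiv (AmbiguousClass.intAut x⁻¹)) ih
    rwa [← MulEquiv.trans_apply, ← AmbiguousClass.mulEquiv_intAut_mul, inv_mul_cancel,
      AmbiguousClass.mulEquiv_intAut_one, MulEquiv.refl_apply, eq_comm] at h2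

variable [NumberField F]

/-- `[L : L^{⟨σ⟩}] = ord σ` divides `3` when `σ³ = 1`, so it is prime to every `q` with `3 ∤ q`.
[cite: Washington1997, §10.1] -/
theorem coprime_finrank_fixedField_zpowers_of_pow_three (σ : L ≃ₐ[F] L) (hσ : σ ^ 3 = 1) {q : ℕ}
    (hq : Nat.Coprime 3 q) :
    Nat.Coprime (Module.finrank (IntermediateField.fixedField (Subgroup.zpowers σ)) L) q := by
  haveI : FiniteDimensional F L := Module.Finite.of_restrictScalars_finite ℚ F L
  rw [IntermediateField.finrank_fixedField_eq_card, Nat.card_zpowers]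
  exact Nat.Coprime.coprime_dvd_left (orderOf_dvd_of_pow_eq_one hσ) hq

variable [IsGalois F L]

/-- **The `S₃` class number relation, `q`-torsion form (`3 ∤ q`, e.g. `q = 2^m`).**  `L/F` Galois number fields,
`σ, τ ∈ Gal(L/F)` with `σ³ = 1`, `τ² = 1`, `τσ = σ²τ`; with `Cl(L)[q] = {c : c^q = 1}` and the Galois action
`c ↦ ClassGroup.mulEquiv (intAut g) c`:
`#Cl(L)[q] · #{c ∈ Cl(L)[q] : σc = c ∧ τc = c}² = #Cl(L^{⟨σ⟩})[q] · #{c ∈ Cl(L)[q] : τc = c}²`.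
For `2 ∤ q` this is the odd part of the Brauer–Kuroda relation of `S₃`; for `q = 2^m` the `τ`-fixed classes are the
ambiguous classes of the quadratic extension `L/L^{⟨τ⟩}` of the cubic subfield. [cite: Lemmermeyer1994, §1]
[cite: NeukirchANT1999, Ch. III §1 Prop. (1.6) (ii), (iv)] -/
theorem card_torsion_classGroup_symmetricThree (σ τ : L ≃ₐ[F] L) (hσ : σ ^ 3 = 1) (hτ : τ ^ 2 = 1)
    (hτσ : τ * σ = σ ^ 2 * τ) {q : ℕ} (hq : Nat.Coprime 3 q) :
    Nat.card {c : ClassGroup (𝓞 L) // c ^ q = 1} *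
        Nat.card {c : ClassGroup (𝓞 L) // c ^ q = 1 ∧ ClassGroup.mulEquiv (AmbiguousClass.intAut σ) c = c ∧
          ClassGroup.mulEquiv (AmbiguousClass.intAut τ) c = c} ^ 2 =
      Nat.card {d : ClassGroup (𝓞 (IntermediateField.fixedField (Subgroup.zpowers σ))) // d ^ q = 1} *
        Nat.card {c : ClassGroup (𝓞 L) // c ^ q = 1 ∧ ClassGroup.mulEquiv (AmbiguousClass.intAut τ) c = c} ^ 2 := by
  let act : (L ≃ₐ[F] L) → ClassGroup (𝓞 L) →* ClassGroup (𝓞 L) :=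
    fun g => (ClassGroup.mulEquiv (AmbiguousClass.intAut g)).toMonoidHom
  have act_apply : ∀ g c, act g c = ClassGroup.mulEquiv (AmbiguousClass.intAut g) c := fun _ _ => rfl
  have act_mul : ∀ g h c, act (g * h) c = act g (act h c) := by
    intro g h c
    rw [act_apply, act_apply, act_apply, AmbiguousClass.mulEquiv_intAut_mul, MulEquiv.trans_apply]
  have act_one : ∀ c, act 1 c = c := by
    intro c; rw [act_apply, AmbiguousClass.mulEquiv_intAut_one, MulEquiv.refl_apply]
  have hσ' : ∀ c, act σ (act σ (act σ c)) = c := fun c => by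
    rw [← act_mul, ← act_mul, ← pow_two, ← pow_succ, hσ, act_one]
  have hτ' : ∀ c, act τ (act τ c) = c := fun c => by rw [← act_mul, ← pow_two, hτ, act_one]
  have hτσ' : ∀ c, act τ (act σ c) = act σ (act σ (act τ c)) := fun c => by
    rw [← act_mul, ← act_mul, ← act_mul, hτσ, pow_two]
  have main := card_torsion_mul_card_fixed_sq_symmetricThree (act σ) (act τ) hσ' hτ' hτσ' hq
  -- `σ`-fixed `q`-torsion classes = `q`-torsion classes of `L^{⟨σ⟩}`
  have eK := KurodaOddPart.card_torsion_fixed_eq_card_torsion_fixedField F L (Subgroup.zpowers σ)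
    (coprime_finrank_fixedField_zpowers_of_pow_three F L σ hσ hq)
  have fz : ∀ c : ClassGroup (𝓞 L),
      (∀ g ∈ Subgroup.zpowers σ, ClassGroup.mulEquiv (AmbiguousClass.intAut g) c = c) ↔ act σ c = c := by
    intro c
    refine ⟨fun h => h σ (Subgroup.mem_zpowers σ), fun h => ?_⟩
    rw [Subgroup.zpowers_eq_closure]
    exact forall_mem_closure_smul_eq_of_forall F L (fun g hg => by rw [Set.mem_singleton_iff.mp hg]; exact h)
  have c1 : Nat.card {c : ClassGroup (𝓞 L) // c ^ q = 1 ∧ ClassGroup.mulEquiv (AmbiguousClass.intAut σ) c = c ∧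
      ClassGroup.mulEquiv (AmbiguousClass.intAut τ) c = c} =
      Nat.card {c : ClassGroup (𝓞 L) // c ^ q = 1 ∧ act σ c = c ∧ act τ c = c} :=
    Nat.card_congr (Equiv.subtypeEquivRight fun _ => Iff.rfl)
  have c2 : Nat.card {c : ClassGroup (𝓞 L) // c ^ q = 1 ∧ ClassGroup.mulEquiv (AmbiguousClass.intAut τ) c = c} =
      Nat.card {c : ClassGroup (𝓞 L) // c ^ q = 1 ∧ act τ c = c} :=
    Nat.card_congr (Equiv.subtypeEquivRight fun _ => Iff.rfl)
  rw [c1, c2, ← eK, Nat.card_congr (Equiv.subtypeEquivRight fun c => and_congr_right fun _ => fz c)]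
  exact main

/-- **The `q`-torsion class number of an `S₃`-extension is that of its quadratic resolvent times a perfect square**
(`3 ∤ q`): `#Cl(L)[q] = #Cl(L^{⟨σ⟩})[q] · t²`, `t = [Cl(L)[q]^{⟨τ⟩} : Cl(L)[q]^{⟨σ,τ⟩}]` the index of the
`⟨σ, τ⟩`-fixed among the `τ`-ambiguous `q`-torsion classes.  (For `q = 2^m` and `L/ℚ` an `S₃`-sextic: `h₂(L) = h₂(K)·□`.)
[cite: Lemmermeyer1994, §1] [cite: NeukirchANT1999, Ch. III §1 Prop. (1.6) (ii), (iv)] -/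
theorem card_torsion_classGroup_eq_card_torsion_fixedField_mul_sq (σ τ : L ≃ₐ[F] L) (hσ : σ ^ 3 = 1)
    (hτ : τ ^ 2 = 1) (hτσ : τ * σ = σ ^ 2 * τ) {q : ℕ} (hq : Nat.Coprime 3 q) :
    ∃ t : ℕ, 0 < t ∧
      Nat.card {c : ClassGroup (𝓞 L) // c ^ q = 1 ∧ ClassGroup.mulEquiv (AmbiguousClass.intAut τ) c = c} =
        t * Nat.card {c : ClassGroup (𝓞 L) // c ^ q = 1 ∧ ClassGroup.mulEquiv (AmbiguousClass.intAut σ) c = c ∧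
          ClassGroup.mulEquiv (AmbiguousClass.intAut τ) c = c} ∧
      Nat.card {c : ClassGroup (𝓞 L) // c ^ q = 1} =
        Nat.card {d : ClassGroup (𝓞 (IntermediateField.fixedField (Subgroup.zpowers σ))) // d ^ q = 1} * t ^ 2 := by
  have main := card_torsion_classGroup_symmetricThree F L σ τ hσ hτ hτσ hq
  -- the two fixed sets as subgroups `C ≤ B` of `Cl(L)`
  let fσ : ClassGroup (𝓞 L) →* ClassGroup (𝓞 L) := (ClassGroup.mulEquiv (AmbiguousClass.intAut σ)).toMonoidHom
  let fτ : ClassGroup (𝓞 L) →* ClassGroup (𝓞 L) := (ClassGroup.mulEquiv (AmbiguousClass.intAut τ)).toMonoidHom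
  let B : Subgroup (ClassGroup (𝓞 L)) := (powMonoidHom q).ker ⊓ fτ.eqLocus (MonoidHom.id _)
  let C : Subgroup (ClassGroup (𝓞 L)) := B ⊓ fσ.eqLocus (MonoidHom.id _)
  have hCB : C ≤ B := inf_le_left
  have memB : ∀ c, c ∈ B ↔ c ^ q = 1 ∧ ClassGroup.mulEquiv (AmbiguousClass.intAut τ) c = c := fun c => by
    rw [Subgroup.mem_inf, MonoidHom.mem_ker, powMonoidHom_apply]
    exact Iff.rfl
  have memC : ∀ c, c ∈ C ↔ c ^ q = 1 ∧ ClassGroup.mulEquiv (AmbiguousClass.intAut σ) c = c ∧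
      ClassGroup.mulEquiv (AmbiguousClass.intAut τ) c = c := fun c => by
    rw [Subgroup.mem_inf, memB]
    exact ⟨fun h => ⟨h.1.1, h.2, h.1.2⟩, fun h => ⟨⟨h.1, h.2.2⟩, h.2.1⟩⟩
  have cardB : Nat.card B =
      Nat.card {c : ClassGroup (𝓞 L) // c ^ q = 1 ∧ ClassGroup.mulEquiv (AmbiguousClass.intAut τ) c = c} :=
    Nat.card_congr (Equiv.subtypeEquivRight memB)
  have cardC : Nat.card C = Nat.card {c : ClassGroup (𝓞 L) // c ^ q = 1 ∧
      ClassGroup.mulEquiv (AmbiguousClass.intAut σ) c = c ∧ ClassGroup.mulEquiv (AmbiguousClass.intAut τ) c = c} :=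
    Nat.card_congr (Equiv.subtypeEquivRight memC)
  -- the index `t = [B : C]`
  have hidx : Nat.card (C.subgroupOf B) * (C.subgroupOf B).index = Nat.card B := Subgroup.card_mul_index _
  rw [Nat.card_congr (Subgroup.subgroupOfEquivOfLe hCB).toEquiv] at hidx
  have hC0 : Nat.card C ≠ 0 := Nat.card_pos.ne'
  have ht0 : (C.subgroupOf B).index ≠ 0 := fun h0 => by
    rw [h0, mul_zero] at hidx
    exact Nat.card_pos.ne' hidx.symm
  refine ⟨(C.subgroupOf B).index, Nat.pos_of_ne_zero ht0, ?_, ?_⟩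
  · rw [← cardB, ← cardC, ← hidx, mul_comm]
  · rw [← cardB, ← cardC, ← hidx] at main
    have h2 : Nat.card {c : ClassGroup (𝓞 L) // c ^ q = 1} * Nat.card C ^ 2 =
        (Nat.card {d : ClassGroup (𝓞 (IntermediateField.fixedField (Subgroup.zpowers σ))) // d ^ q = 1} *
          (C.subgroupOf B).index ^ 2) * Nat.card C ^ 2 := by rw [main]; ring
    exact mul_right_cancel₀ (pow_ne_zero 2 hC0) h2

end Field

end Literature.NumberTheory.NumberFields.KurodaSymmetricThree

end
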